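import Summits.Langlands.Langlands.Theses.GaloisWeightedBE
import Literature.NumberTheory.LFunctions.StarkNoQuadraticSubfieldProofs
import HarnessLib

/-!
# Birth skeleton — piece `GaloisMultipleZerosOnLine` of the decomposition of crux #4
# `ExtendedRiemannHypothesis` (route GaloisWeightedBE, parent crux stmt-Langlands-14565;
# strategist planner-cstrat-stmt-Langlands-14565-r1-0)

Two named stubs in the tree's Heilbronn vocabulary (`artinOrder s (χ ∘ q)` = the order at `s` of
the Artin `L`-series of the character `χ ∘ q` of `Γ_ℚ`, `q : Γ_ℚ → G` a finite Galois quotient,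
`IsArtinQuotient q`) and the kernel-checked composition `GaloisMultipleZerosOnLine_of`.

* `stub_nonlinearArtinOrderZero` (OPEN — GRH off the line + Artin holomorphy off the line for the
  IRREDUCIBLE NON-LINEAR Artin `L`-functions over `ℚ`): for `s` in the open strip OFF the critical
  line and every irreducible character `χ` of `G` with `χ(1) ≠ 1`, `n(G, χ) := ord_s L(s, χ ∘ q) = 0`.
* `stub_linearArtinOrderSumLeOne` (OPEN, strictly weaker than GRH for Dirichlet `L`-functions as far
  as is known — "off-line zeros of Dirichlet `L`-functions are simple and not shared"): for `s` in
  the open strip off the line, `Σ_{χ linear} n(G, χ) ≤ 1` (each term is `≥ 0`: Hecke/Dirichlet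
  `L`-functions are entire, `ζ` is holomorphic at `s ≠ 1`).

Composition: a multiple zero `ζ_N(s) = ζ_N'(s) = 0` has `ord_s ζ_N ≥ 2` (Taylor); embed `N ↪ ℚ̄`,
`N₀ = f(N)` is normal, `q : Γ_ℚ → Gal(N₀/ℚ)`; Heilbronn: `ord_s ζ_N = θ_G(1) = Σ_χ χ(1)·n(G,χ)`
(tree `heilbronnChar_one`, `heilbronnChar_one_eq_sum`, `artinOrder_leftRegular`); the first stub
kills the non-linear terms, the second bounds the rest by `1`: contradiction. Sorries ONLY in `stub_*`.
-/

noncomputable section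

namespace Summit.Langlands.Langlands.Cruxes.ExtendedRiemannHypothesis.BirthGaloisMultipleZerosOnLine

open scoped NumberField ComplexConjugate
open Complex Filter Topology NumberField IntermediateField
open Literature.NumberTheory.Automorphic Literature.NumberTheory.LFunctions
  Literature.NumberTheory.LFunctions.Heilbronn Literature.NumberTheory.LFunctions.NumberField
  Literature.RepresentationTheory.FiniteGroups

attribute [local instance 1001] AlgebraicClosure.instAlgebra IntermediateField.algebra'
  IntermediateField.module'

/-- The piece, verbatim (child `GaloisMultipleZerosOnLine` of `ExtendedRiemannHypothesis`). -/
def GaloisMultipleZerosOnLine : Prop :=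
  ∀ (N : Type) [Field N] [NumberField N] [IsGalois ℚ N] (s : ℂ), 0 < s.re → s.re < 1 →
    Literature.NumberTheory.LFunctions.dedekindZetaCont N s = 0 →
    deriv (Literature.NumberTheory.LFunctions.dedekindZetaCont N) s = 0 → s.re = 1 / 2

/-- **stub_nonlinearArtinOrderZero** (OPEN): for a finite Galois quotient `q : Γ_ℚ → G` and `s` in the
open critical strip OFF the line `Re s = 1/2`, every irreducible character `χ` of `G` of degree
`χ(1) ≠ 1` has `n(G, χ) = ord_s L(s, χ ∘ q) = 0` (no zero, no pole: GRH off the line together with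
Artin's holomorphy conjecture off the line, for the non-abelian irreducible Artin `L`-functions
over `ℚ`). [cite: MurtyMurty1997, Ch. 2 §5–6] [cite: IwaniecKowalski2004, §5.13] -/
theorem stub_nonlinearArtinOrderZero : ∀ (G : Type) [Group G] [Fintype G]
    (q : Field.absoluteGaloisGroup ℚ →* G), IsArtinQuotient q → ∀ (s : ℂ), 0 < s.re → s.re < 1 →
    s.re ≠ 1 / 2 → ∀ χ : G → ℂ, IsIrrChar G χ → χ 1 ≠ 1 → artinOrder s (χ ∘ q) = 0 := by
  sorry

/-- **stub_linearArtinOrderSumLeOne** (OPEN; implied by GRH for Dirichlet `L`-functions, not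
conversely as far as is known): for a finite Galois quotient `q : Γ_ℚ → G` and `s` in the open
critical strip off the line, `Σ_{χ irreducible, χ(1) = 1} ord_s L(s, χ ∘ q) ≤ 1` — the degree-one
(`=` Dirichlet, by Artin reciprocity over `ℚ`) `L`-functions of `N` have, off the line, only simple
zeros, no two of them at the same point. [cite: DavenportMNT1980, Ch. 20] [cite: MurtyMurty1997, Ch. 2 §5] -/
theorem stub_linearArtinOrderSumLeOne : ∀ (G : Type) [Group G] [Fintype G]
    (q : Field.absoluteGaloisGroup ℚ →* G), IsArtinQuotient q → ∀ (s : ℂ), 0 < s.re → s.re < 1 →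
    s.re ≠ 1 / 2 →
    (∑ χ ∈ (irrChars_finite_holds G).toFinset with χ 1 = 1, artinOrder s (χ ∘ q)) ≤ 1 := by
  sorry

/-- A zero of `f` which is also a zero of `f'` is a zero of order `≥ 2` (Taylor). [folklore] -/
theorem two_le_meromorphicOrderAt {f : ℂ → ℂ} {s : ℂ} (hf : AnalyticAt ℂ f s) (hz : f s = 0)
    (hd : deriv f s = 0) : ((2 : ℤ) : WithTop ℤ) ≤ meromorphicOrderAt f s := by
  have h2 : ((2 : ℕ) : ℕ∞) ≤ analyticOrderAt f s := by
    rw [natCast_le_analyticOrderAt_iff_iteratedDeriv_eq_zero hf]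
    intro i hi
    interval_cases i
    · simpa using hz
    · simpa using hd
  rw [hf.meromorphicOrderAt_eq]
  cases h : analyticOrderAt f s with
  | top => simp
  | coe n =>
    rw [h] at h2
    have h2' : 2 ≤ n := by exact_mod_cast h2
    rw [ENat.map_coe]
    exact_mod_cast h2'

/-- **COMPOSITION** (kernel-checked, sorry-free): `GaloisMultipleZerosOnLine` from the two stub
statements, through Heilbronn's identity `ord_s ζ_N = θ_G(1) = Σ_χ χ(1) · n(G, χ)`. [folklore] -/
theorem GaloisMultipleZerosOnLine_of :
    (∀ (G : Type) [Group G] [Fintype G] (q : Field.absoluteGaloisGroup ℚ →* G), IsArtinQuotient q →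
      ∀ (s : ℂ), 0 < s.re → s.re < 1 → s.re ≠ 1 / 2 →
      ∀ χ : G → ℂ, IsIrrChar G χ → χ 1 ≠ 1 → artinOrder s (χ ∘ q) = 0) →
    (∀ (G : Type) [Group G] [Fintype G] (q : Field.absoluteGaloisGroup ℚ →* G), IsArtinQuotient q →
      ∀ (s : ℂ), 0 < s.re → s.re < 1 → s.re ≠ 1 / 2 →
      (∑ χ ∈ (irrChars_finite_holds G).toFinset with χ 1 = 1, artinOrder s (χ ∘ q)) ≤ 1) →
    GaloisMultipleZerosOnLine := by
  intro hNL hL N _ _ _ s hpos hlt hz hd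
  classical
  by_contra hne
  have hs1 : s ≠ 1 := by
    intro h
    rw [h, one_re] at hlt
    exact lt_irrefl _ hlt
  -- embed `N ↪ ℚ̄`; the image `N₀ = f(N)` is normal over `ℚ`; `q : Γ_ℚ → Gal(N₀/ℚ)`
  let L := AlgebraicClosure ℚ
  let f : N →ₐ[ℚ] L := IsAlgClosed.lift
  let N₀ : IntermediateField ℚ L := f.fieldRange
  have eN : N ≃ₐ[ℚ] N₀ := f.equivFieldRange
  haveI : Normal ℚ N₀ := Normal.of_algEquiv eN
  haveI : FiniteDimensional ℚ N₀ := LinearEquiv.finiteDimensional eN.toLinearEquiv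
  obtain ⟨q, hq⟩ : ∃ q : Field.absoluteGaloisGroup ℚ →* (N₀ ≃ₐ[ℚ] N₀),
      q = AlgEquiv.restrictNormalHom N₀ := ⟨_, rfl⟩
  have hqA : IsArtinQuotient q := isArtinQuotient_of_eq_restrictNormalHom hq
  haveI hNF : ∀ H', NumberField (quotientFixedField q H') :=
    fun H' => numberField_quotientFixedField hqA H'
  have hbot : quotientFixedField q ⊥ = N₀ := quotientFixedField_bot_of_eq_restrictNormalHom hq
  have e : quotientFixedField q (⊥ : Subgroup (N₀ ≃ₐ[ℚ] N₀)) ≃+* N :=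
    ((IntermediateField.equivOfEq hbot).trans eN.symm).toRingEquiv
  -- `ord_s ζ_N ≥ 2`, i.e. `n(G, reg) ≥ 2`
  set G := (N₀ ≃ₐ[ℚ] N₀) with hG
  have h2 : ((2 : ℤ) : WithTop ℤ) ≤ meromorphicOrderAt (dedekindZetaCont N) s :=
    two_le_meromorphicOrderAt (analyticAt_dedekindZetaCont hs1) hz hd
  have hreg : (artinOrder s ((Representation.leftRegular ℂ G).character ∘ q) : WithTop ℤ) =
      meromorphicOrderAt (dedekindZetaCont N) s := by
    rw [artinOrder_leftRegular hqA s, meromorphicOrderAt_dedekindZetaCont_eq_of_ringEquiv e hs1]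
  have he2 : (2 : ℤ) ≤ artinOrder s ((Representation.leftRegular ℂ G).character ∘ q) := by
    rw [← hreg] at h2
    exact_mod_cast h2
  -- Heilbronn: `n(G, reg) = θ_G(1) = Σ_χ n(G,χ) χ(1)`; the non-linear terms vanish (first stub)
  set T := (irrChars_finite_holds G).toFinset with hT
  have hmemT : ∀ {χ : G → ℂ}, χ ∈ T ↔ IsIrrChar G χ :=
    fun {χ} => (irrChars_finite_holds G).mem_toFinset
  have hθ1 : heilbronnChar q s 1 =
      (artinOrder s ((Representation.leftRegular ℂ G).character ∘ q) : ℂ) := heilbronnChar_one hqA s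
  have hsum : heilbronnChar q s (1 : G) = ∑ χ ∈ T, (artinOrder s (χ ∘ q) : ℂ) * χ 1 :=
    heilbronnChar_one_eq_sum (q := q) s
  have hsplit : (∑ χ ∈ T, (artinOrder s (χ ∘ q) : ℂ) * χ 1) =
      ∑ χ ∈ T with χ 1 = 1, (artinOrder s (χ ∘ q) : ℂ) := by
    rw [Finset.sum_filter]
    refine Finset.sum_congr rfl fun χ hχ => ?_
    by_cases h1 : χ 1 = 1
    · simp [h1]
    · have h0 : artinOrder s (χ ∘ q) = 0 := hNL G q hqA s hpos hlt hne χ (hmemT.mp hχ) h1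
      simp [h0, h1]
  have hcast : (artinOrder s ((Representation.leftRegular ℂ G).character ∘ q) : ℂ) =
      ((∑ χ ∈ T with χ 1 = 1, artinOrder s (χ ∘ q) : ℤ) : ℂ) := by
    rw [← hθ1, hsum, hsplit]
    push_cast
    rfl
  have heq : artinOrder s ((Representation.leftRegular ℂ G).character ∘ q) =
      ∑ χ ∈ T with χ 1 = 1, artinOrder s (χ ∘ q) := by exact_mod_cast hcast
  -- the linear terms sum to at most `1` (second stub): contradiction with `ord ≥ 2`
  have hle : (∑ χ ∈ T with χ 1 = 1, artinOrder s (χ ∘ q)) ≤ 1 := hL G q hqA s hpos hlt hne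
  omega

/-- Registered (closed) form. [folklore] -/
theorem GaloisMultipleZerosOnLine_from_stubs : GaloisMultipleZerosOnLine :=
  GaloisMultipleZerosOnLine_of stub_nonlinearArtinOrderZero stub_linearArtinOrderSumLeOne

end Summit.Langlands.Langlands.Cruxes.ExtendedRiemannHypothesis.BirthGaloisMultipleZerosOnLine

end
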